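import Literature.NumberTheory.EllipticCurves.LocalUniversalNorms
import Literature.NumberTheory.EllipticCurves.IsogenyQuadraticTwistProofs
import Literature.NumberTheory.EllipticCurves.Tamagawa
import Literature.NumberTheory.EllipticCurves.GlobalMinimalModel
import HarnessLib

/-!
# Mazur 1972, Corollary 5.15: the UNIVERSAL NORM INDEX of a good ORDINARY elliptic curve over `ℤ_p`
# along the cyclotomic `ℤ_p`-tower, over `ℚ_p` and over a totally ramified base — `1` or `p²`
# (named fact, weaker than print)

Topic `NumberTheory/EllipticCurves`, sub-directory `Mazur1972` (namespace = path). ONE named fact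
(`cor515_universalNormIndex`, a `def … : Prop`, D-0014), nothing else. Written for the cell
`bsd-addord` (run/shared/lean/pub/bsd-addord/; seat `bsd-addord-twist`, target T-ANOM, route R1 of
TARGET.md §6 S36″, input (T2)): it evaluates the object `localUniversalNormIndex` of
`Literature/NumberTheory/EllipticCurves/LocalUniversalNorms.lean` in the two situations Mazur's Remark
names, which are the two the cell's twist transport needs (the good ordinary twist `V = E ⊗ χ_{p*}` of
an additive potentially-good-ordinary `E` of defect `2`, over `ℚ_p` and over `ℚ_p(√p*) ⊆ ℚ_p(ζ_p)`).

## The printed statements (B. Mazur, *Rational points of abelian varieties with values in towers of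
number fields*, Invent. Math. 18 (1972) 183–266; GDZ scan PPN356556735_0018, read by eye by the cell's
literature seat, dossier `HOME/lit/mazur1972/STATEMENTS.md`)

* §4 p. 216, standing hypotheses of (4.29)–(4.33): "`k` is a finite field, `Â` a formal Lie group over
  `D`, of dimension `d`, of multiplicative type with twist matrix `u`. Let `L/K` be a totally ramified
  finite Galois extension of degree a power of `p = char(k)`" — NO hypothesis on the absolute
  ramification index `e(K/ℚ_p)`, none on `p`.
* Cor. 4.33 (p. 218): "Then `N_{L/K}Â(E)` is of finite index in `Â(D)`, and `Â(D)/N_{L/K}Â(E) ≈ Γ^d/(1−u)Γ^d`.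
  Proof. … the cokernel of `N_{K_m/K}` is isomorphic to `(Γ/Γ_m)^d/(1−u)(Γ/Γ_m)^d`. By hypothesis,
  `1 − u` is nonsingular. Thus the order of these groups are constant for large `m`, and in fact
  isomorphic to `Γ^d/(1−u)Γ^d`"; Prop. 4.39 (pp. 220–221): "Let `A` be an ordinary abelian scheme over
  `D` (whose residue field `k` is finite), of dimension `d`. Let `L/K` be any `Γ`-extension. Then
  `A(K)/N_{L/K}A(L)` is finite … If `L/K` is a totally ramified `Γ`-extension, then … (4.40)
  `Γ^d/(1−u)Γ^d → A(K)/N_{L/K}A(L) → p-part of A(k) → 0`" (proof: "by (4.33) and (4.38) the above groups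
  stabilize for large `m`"); p. 226: "`N` is `N_{K̂_n/K̂}A′(K̂_n)` for large `n`, 'the subgroup of
  universal norms'"; (5.6) p. 226: "`0 → {A(K̂)/N}* → H²(X, Ã) → H²(Y, Ã)^Γ → 0`", i.e. `E_0 = {A(K̂)/N}*`
  in (5.8)/(5.9), and (proof of Cor. 5.7, pp. 226–227) "The groups `E_n` are seen to be all
  (noncanonically) isomorphic for varying `n`."
* p. 228: "`h(x) = x² − a_p x + p` … If `A` is ordinary, then the twist matrix `u` is just a unit of `ℤ_p`,
  and `u, p/u` are the roots of … `h(x)`. One has, also, that the order of the group `A(k)` is just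
  `h(1) = 1 + p − a_p`. Let `e_p = ord_p(h(1))`."; Lemma 5.14 (i) (p. 229): "If `p > 2`, then
  `e_p = ord_p(1−u) = ord_p(h(1))` is either one or zero" [and `e_p = 0` iff `a_p ≢ 1 mod p`; the
  printed "if and only if `a_p ≡ 1`" is a slip inverted relative to 5.15 (i)/(ii), which are printed
  the right way round — dossier §ANSWER (b), zoom image `img-gdz/p229_lemma514_zoom.jpg`].
* **Cor. 5.15 (p. 229).** "Let `K/ℚ_p` be a totally ramified finite extension. Let `D ⊂ K` denote the
  ring of integers, and `X = Spec(D)`. Let `Y/X` be a totally ramified `Γ`-extension. Let `A` be an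
  ordinary abelian scheme of dimension one, over `Spec(ℤ_p)`. Denote by the same letter its base change
  to `X`. Then the groups `E_n` of (5.8) may be computed as follows: (i) `E_n` is trivial if
  `a_p ≢ 1 mod p`. (ii) `E_n` is isomorphic to `ℤ/p ⊕ ℤ/p` if `a_p ≡ 1 mod p`. **Remark.** We shall use
  this corollary in two situations (cf. §8, (a) and (b)). Namely, when `K = ℚ_p`, and `K = ℚ_p(ζ_p)`."
  (Proof: "By (5.11) there is a lifting of the `p`-torsion points of `A(k)` to `A(ℚ_p)`, and hence to
  `A(K)`. Thus Corollary 5.7 applies. Since `h(1)` is the order of `A(k)`, `p^{e_p}` is the order of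
  `{A(k)}*`. By (5.14)(i), `e_p` is either `0` or `1`. Thus `{A(k)}* ≈ ℤ/p^{e_p}`. Also,
  `Γ/(1−u)Γ ≈ ℤ/p^{e_p}`. This evaluates the split exact sequence (5.9). Q.E.D." — `p > 2` enters through
  Lemma 5.11 / 5.14 (i).) ⟦sic, on (ii) and its proof sentence "By (5.11) there is a lifting …":
  Lemma 5.11's printed proof (p. 227: "Suppose not. Hence there is an element `a ∈ _pA(D)` which goes
  to zero …"; "`μ_p` can have no nontrivial section over any unramified extension of `ℤ_p`, provided
  `p > 2`") gives INJECTIVITY of `A(D)[p] → A(k)[p]` only; the SURJECTIVITY used as a lifting fails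
  when `E(ℚ_p)[p] = 0 ≠ Ẽ(𝔽_p)[p]` (Kim 2022 §3.1.1 / Prop. 3.2: "`E(ℚ_p)[p]` is non-trivial if and
  only if `Ẽ(𝔽_p)[p]` is non-trivial and [the reduction sequence] splits"), so Mazur's own derivation
  of the STRUCTURE clause (ii) does not apply at a non-split anomalous `p`. The ORDER `#E_0 = p^{2e_p}`
  — the only thing typed below — is proved in print along lifting-free roads: Schneider, Invent. Math.
  71 (1983) §7 Prop. 2 (p. 282) with proof p. 284 ("`#H¹(G_𝔭, A(k_{𝔭,∞}))(p) = |det(U−1)|_p^{−1} ·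
  #Ã(κ_𝔭)(p) = (#Ã(κ_𝔭)(p))²`", any `𝔭 ∣ p` of ordinary good reduction), Jones, J. Algebra 138 (1991)
  Prop. 2.1 (left-exactness of (4.40) unconditionally, by Herbrand-quotient counting + Tate duality +
  the finiteness of Lubin–Rosen, J. Algebra 52 (1978) Thm. 1); the structure `ℤ/p ⊕ ℤ/p` is NOT
  asserted here. (ARM P reader r11 S5 `D-AUDIT-r11-S5-Mazur72Cor515.md` FINDING F1, kit
  `sheets/r11-S5-maz72/`; informational flag `Maz72-L5.11-lifting@anomalous-nonsplit (order =
  Sch83-§7-Prop2 / Jon91-Prop2.1)` booked PROVISIONAL pending the cell desk C3; lead RULING (322);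
  DD-121.)⟧

## The fact below (weaker than print)

Setting: `V/ℚ` a globally minimal elliptic curve with GOOD reduction at an ODD prime `p` and ORDINARY
there (`p ∤ a_p(V)`, `a_p = V.frobeniusTrace p`), so that its Néron model over `ℤ_p` is "an ordinary
abelian scheme of dimension one over `Spec(ℤ_p)`" with `#A(𝔽_p) = 1 + p − a_p`; `κ` the CYCLOTOMIC
`ℤ_p`-extension of `ℚ` (`ZpExtension.IsCyclotomic`); `v` the place of `ℚ` above `p` and
`E = ℚ_v = ℚ_p` (`v.adicCompletion ℚ`); the tower seen from a subgroup `U ≤ Γ_{ℚ_p}`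
(`localLayer`, `localUniversalNorms`, `localUniversalNormIndex` of `LocalUniversalNorms.lean`). Two bases:
(a) `U = Γ_{ℚ_p}` — `K = ℚ_p`, `Y = ℚ_p(μ_{p^∞})^{(ℤ_p)}`-tower `ℚ_{p,∞}/ℚ_p`, totally ramified;
(b) `U = Γ_{ℚ_p(√p*)}` = the stabiliser in `Γ_{ℚ_p}` of `√p* ∈ ℚ̄_p`, `p* = (−1)^{(p−1)/2} p` —
`K = ℚ_p(√p*)`, the quadratic subfield of `ℚ_p(ζ_p)`, TOTALLY RAMIFIED over `ℚ_p`, and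
`Y = K·ℚ_{p,∞} ⊆ ℚ_p(μ_{p^∞})`, totally ramified over `ℚ_p` hence a totally ramified `Γ`-extension of
`K` (inside the printed hypotheses of Cor. 5.15: "`K/ℚ_p` … totally ramified finite"; the Remark's own
second case `ℚ_p(ζ_p)` contains it). In both cases the layers `U_n` of `localLayer` cut out
`K·ℚ_{p,n}`, the `n`-th layer of `Y/K` (`p` is totally ramified in the cyclotomic tower, so the
completed global layer is the local layer), the universal norms of `LocalUniversalNorms.lean` (the
intersection of the finite-layer norm groups) are Mazur's `N` (Cor. 4.33 / p. 226: the norm groups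
decrease and stabilise), `A(K) = V(K)` (Néron mapping property; good reduction is preserved by base
change, so the base-changed scheme is the Néron model over `D`), and (5.6) + Cor. 5.15 give
**`#(V(K)/N_∞) = #E_0 = p^{2 e_p}`, `e_p = 1` if `a_p ≡ 1 (mod p)` and `0` otherwise** — stated as the
value of `localUniversalNormIndex` (`AddSubgroup.index`, so the statement includes the finiteness of
the index). Weaker than print (dimension one only; only the two bases (a), (b); only the cyclotomic
tower). No `_holds` (size L: flat cohomology of the Néron model over the tower, Mazur §§4–5).
`-- TODO(general form): any totally ramified finite K/ℚ_p, any totally ramified Γ-extension Y/X, ordinary abelian schemes of any dimension over ℤ_p ((5.9) with Γ^g/(1−u)Γ^g).`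

## References
* B. Mazur, Invent. Math. 18 (1972) 183–266: §4 (4.31)–(4.33), Prop. 4.39–(4.43), §5 (5.6)–(5.9),
  Cor. 5.7, Lemma 5.11, Lemma 5.14, Cor. 5.15 + Remark, Cor. 5.16. [Mazur1972Towers]
* D. Delbourgo, J. Number Theory 95 (2002) 38–71, p. 61 ("If `E` has good reduction over `K_{v_p}` then
  Mazur [Ma] proved that `[E(K_{v_p}) : N_∞E(K_{v_p})]` equals the square of the `p`-torsion in the
  reduction of `E` over `K_{v_p}`"), p. 69. [Delbourgo2002]
-/

noncomputable section

open scoped Classical NumberField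

open IsDedekindDomain NumberField WeierstrassCurve Field

namespace Literature.NumberTheory.EllipticCurves.Mazur1972

/-- **Mazur 1972, Cor. 5.15 with (5.6) (the universal norm index of a good ordinary elliptic curve over
`ℤ_p` along the cyclotomic `ℤ_p`-tower), weaker than print.** Let `V/ℚ` be globally minimal with good
ORDINARY reduction at an odd prime `p` (`p ∤ a_p(V)`), `κ` the cyclotomic `ℤ_p`-extension of `ℚ`, `v`
the place above `p`, `ℚ_v = ℚ_p` its completion. For `U = Γ_{ℚ_p}` (base `K = ℚ_p`) and for
`U = Stab_{Γ_{ℚ_p}}(√p*)` (base `K = ℚ_p(√p*) ⊆ ℚ_p(ζ_p)`, totally ramified over `ℚ_p`), the universal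
norms `N_∞ = ⋂_n N_{K·ℚ_{p,n}/K} V(K·ℚ_{p,n})` have index
**`[V(K) : N_∞] = p^{2e_p}`, `e_p = 1` if `p ∣ a_p(V) − 1` (anomalous) and `e_p = 0` otherwise**
("`E_n` is trivial if `a_p ≢ 1 mod p`; `E_n ≅ ℤ/p ⊕ ℤ/p` if `a_p ≡ 1 mod p`", `E_0 = {A(K̂)/N}*`; "We
shall use this corollary in two situations … Namely, when `K = ℚ_p`, and `K = ℚ_p(ζ_p)`"). The index
is `localUniversalNormIndex` (`AddSubgroup.index`; its being `p^{2e_p} ≠ 0` includes finiteness). No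
`_holds` (size L). The ORDER typed here is, independently of Mazur's Lemma 5.11 lifting (see the
module docstring's ⟦sic⟧ on Cor. 5.15 (ii)), Schneider 1983 §7 Prop. 2 / Jones 1991 Prop. 2.1 (with
Lubin–Rosen 1978 Thm. 1); the structure clause (ii) is not asserted.
[cite: Mazur1972Towers, Cor. 5.15 with Remark (p. 229), (5.6) (p. 226), Cor. 4.33 (p. 218), Prop. 4.39 (pp. 220–221), Lemma 5.14 (i)]
[cite: Schneider1983, §7 Prop. 2 (p. 282) with proof p. 284]
[cite: Jones1991, Prop. 2.1] [cite: LubinRosen1978, Thm. 1] -/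
def cor515_universalNormIndex : Prop :=
  ∀ (V : WeierstrassCurve ℚ) [V.IsElliptic] [V.IsGloballyMinimal] (p : ℕ) [Fact p.Prime],
    p ≠ 2 → V.HasGoodReductionAtPrime p → ¬ ((p : ℕ) : ℤ) ∣ V.frobeniusTrace p →
    ∀ (κ : ZpExtension ℚ p), κ.IsCyclotomic →
    ∀ (v : HeightOneSpectrum (𝓞 ℚ)), ((p : ℕ) : 𝓞 ℚ) ∈ v.asIdeal →
    ∀ (U : Subgroup (absoluteGaloisGroup (v.adicCompletion ℚ))),
      (U = ⊤ ∨ U = MulAction.stabilizer (absoluteGaloisGroup (v.adicCompletion ℚ))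
          (geomSqrt (algebraMap ℚ (v.adicCompletion ℚ) ((-1 : ℚ) ^ (p / 2) * p)))) →
      localUniversalNormIndex (W := V) (v.adicCompletion ℚ) κ U =
        p ^ (2 * (if ((p : ℕ) : ℤ) ∣ V.frobeniusTrace p - 1 then 1 else 0))

end Literature.NumberTheory.EllipticCurves.Mazur1972

end
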